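import Mathlib.AlgebraicGeometry.AffineSpace
import Mathlib.Algebra.CharP.Lemmas
import Mathlib.CategoryTheory.Sites.Canonical
import Mathlib.CategoryTheory.Sites.SheafCohomology.Basic
import Literature.AlgebraicGeometry.Motives.ConstantEtaleSheaf
import HarnessLib

/-!
# The additive group `𝔾ₐ` on the small étale site `Y_ét`, its Frobenius, and the `K`-linear
# structure of `Hⁿ(Y_ét, 𝔾ₐ)`

Infrastructure for the Artin–Schreier route to the finiteness of `Hⁱ(Y_ét, ℤ/p)` in
characteristic `p` (Milne II 2.18 (c), III §4; `EtaleArtinSchreier.lean`), on Mathlib's carriers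
(`Scheme.Etale`, `Scheme.smallEtaleTopology`, `Sheaf.H`). Everything here is a definition with
its unfolding lemmas or a proved theorem:

* `ΓPresheafAb` : the presheaf `U ↦ Γ(U, 𝓞_U)` (additive group) on `Scheme`; it is represented by
  `𝔸¹_ℤ` (`ΓPresheafAbRepresentableBy`, Mathlib `AffineSpace.toSpecMvPolyIntEquiv`), hence an
  fpqc sheaf (`isSheaf_fpqcTopology_ΓPresheafAb`: Mathlib's subcanonicality of the fpqc topology;
  Milne II Cor. 1.6: `W(F)` is an fpqc sheaf for `F` quasi-coherent);
* `etaleGa Y` : **`𝔾ₐ` on `Y_ét`**, the restriction of `ΓPresheafAb` along the continuous functor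
  `Y.Etale ⥤ Scheme` (as `continuousMapEtSheaf` in `ConstantEtaleSheaf.lean`); sections over
  `U → Y` are `Γ(U, 𝓞_U)` by `rfl`;
* `etaleGaScalar Y : Γ(Y, 𝓞_Y) →+* End 𝔾ₐ` (multiplication by global functions) and, in
  characteristic `p` (`p = 0` in `Γ(Y, 𝓞_Y)`), the Frobenius `etaleGaFrob p hp : 𝔾ₐ ⟶ 𝔾ₐ`,
  `s ↦ s ^ p` (Milne II 2.18 (c)), with `(c ·) ≫ F = F ≫ (c^p ·)`
  (`etaleGaSMul_comp_etaleGaFrob`);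
* `moduleEndSheafH` : on any site, `Hⁿ(F)` is a module over `End F` through Mathlib's
  `Sheaf.H.map` (a `def`, not an instance); for a `K`-scheme `f : Y → Spec K` this gives the
  **`K`-module instance on `Hⁿ(Y_ét, 𝔾ₐ)`** (`moduleEtaleGaOverH`, on the copy `etaleGaOver f` of
  `etaleGa Y` that records `f` in its type), and the Frobenius `φ = Hⁿ(F)` (`frobeniusH`) is
  **`p`-linear**: `φ (c • x) = c ^ p • φ x` (`frobeniusH_smul`), `Hⁿ(F - 1) = φ - id`
  (`sheafH_map_frob_sub_id`).

## References

* J. S. Milne, *Étale cohomology*, Princeton (reissue 2025; held copy, PDF pages): II Cor. 1.6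
  (p. 59), II Examples 2.18 (c) (pp. 74–75: `𝔾_a`, "`F` is the map `a ↦ a^p`"), III 1.5 (a),
  1.6 (e) (`Hⁱ = Extⁱ(ℤ, –)`), III §4 "Artin–Schreier theory" (pp. 137–138). [Milne2025]

## Design notes

* `Y` "of characteristic `p`" is the hypothesis `(p : Γ(Y, ⊤)) = 0` (equivalently `Y` is an
  `𝔽_p`-scheme); it passes to every étale `U → Y` (`cast_eq_zero_etale`). The power map is made
  additive without a `CharP` instance (`add_pow_prime_of_cast_eq_zero`, the zero ring — the empty
  `U` — included).
* `etaleGaOver f := etaleGa Y` is a `def` (not an `abbrev`) so that the `Module K` instance on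
  `(etaleGaOver f).H n` is keyed on `f`; all `Over` statements are phrased with morphisms typed
  over `etaleGaOver f` (`etaleGaSMulOver`, `etaleGaOverFrob`) so that rewriting with
  `Sheaf.H.map_comp_apply` is syntactic.
* Mathlib / Literature searches: `Scheme.Γ`, `AffineSpace.toSpecMvPolyIntEquiv`,
  `GrothendieckTopology.Subcanonical.isSheaf_of_isRepresentable`, `fpqcTopology.Subcanonical`,
  `Sheaf.H.map_add_apply`, `End.mul_def` (Mathlib); `isContinuous_etaleForget_forget`,
  `continuousMapEtSheaf` (`ConstantEtaleSheaf.lean`). No `𝔾ₐ` on any scheme site in Mathlib or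
  Literature; nothing restated.
-/

universe w' w v' u' u

open CategoryTheory Limits Opposite AlgebraicGeometry

noncomputable section

namespace Literature.AlgebraicGeometry.Motives

/-! ### `Hⁿ` is a module over the endomorphism ring of the sheaf (any site) -/

section EndModule

variable {C : Type u'} [Category.{v'} C] {J : GrothendieckTopology C}
  [HasSheafify J AddCommGrpCat.{w}] [HasExt.{w'} (Sheaf J AddCommGrpCat.{w})]

/-- `Hⁿ` of the zero morphism is zero (cf. `sheafH_map_zero_apply` in `EllAdicBockstein.lean`,
stated there with both universes equal; not imported to keep this file light). [folklore] -/
theorem sheafH_map_zero_eq_zero (F G : Sheaf J AddCommGrpCat.{w}) (n : ℕ) (x : F.H n) :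
    Sheaf.H.map (0 : F ⟶ G) n x = 0 := by
  simp [Sheaf.H.map_apply]

/-- `Hⁿ(-f) = -Hⁿ(f)`. [folklore] -/
theorem sheafH_map_neg_apply {F G : Sheaf J AddCommGrpCat.{w}} (f : F ⟶ G) (n : ℕ) (x : F.H n) :
    Sheaf.H.map (-f) n x = -Sheaf.H.map f n x := by
  rw [eq_neg_iff_add_eq_zero, ← Sheaf.H.map_add_apply, neg_add_cancel, sheafH_map_zero_eq_zero]

/-- `Hⁿ(f - g) = Hⁿ(f) - Hⁿ(g)`. [folklore] -/
theorem sheafH_map_sub_apply {F G : Sheaf J AddCommGrpCat.{w}} (f g : F ⟶ G) (n : ℕ)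
    (x : F.H n) : Sheaf.H.map (f - g) n x = Sheaf.H.map f n x - Sheaf.H.map g n x := by
  rw [sub_eq_add_neg, Sheaf.H.map_add_apply, sheafH_map_neg_apply, sub_eq_add_neg]

/-- The cohomology `Hⁿ(F)` of an abelian sheaf is a module over the endomorphism ring `End F`
(`f • x := Hⁿ(f)(x)`; recall `f * g = g ≫ f` in `End F`). A definition, not an instance (the
carrier is Mathlib's); it is instantiated below for `𝔾ₐ`. [folklore] -/
@[reducible] def moduleEndSheafH (F : Sheaf J AddCommGrpCat.{w}) (n : ℕ) :
    Module (End F) (F.H n) where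
  smul f x := Sheaf.H.map f n x
  one_smul x := Sheaf.H.map_id_apply x
  mul_smul f g x := Sheaf.H.map_comp_apply g f x
  smul_zero f := map_zero (Sheaf.H.map f n)
  smul_add f x y := map_add (Sheaf.H.map f n) x y
  add_smul f g x := Sheaf.H.map_add_apply f g x
  zero_smul x := sheafH_map_zero_eq_zero F F n x

end EndModule

/-! ### The presheaf `U ↦ Γ(U, 𝓞_U)` on `Scheme` is an fpqc sheaf -/

/-- The presheaf of abelian groups `U ↦ Γ(U, 𝓞_U)` (global sections of the structure sheaf, as an
additive group) on the category of schemes. [folklore] -/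
def ΓPresheafAb : Scheme.{u}ᵒᵖ ⥤ Ab.{u} where
  obj U := AddCommGrpCat.of Γ(U.unop, ⊤)
  map f := AddCommGrpCat.ofHom (f.unop.appTop).hom.toAddMonoidHom
  map_id U := by
    ext x
    simp
  map_comp f g := by
    ext x
    simp

/-- Sections of `ΓPresheafAb` over `U` are `Γ(U, 𝓞_U)` (by `rfl`). [folklore] -/
theorem ΓPresheafAb_obj (U : Scheme.{u}ᵒᵖ) : (ΓPresheafAb.obj U : Type u) = Γ(U.unop, ⊤) := rfl

/-- Restriction in `ΓPresheafAb` along `f` is `f.appTop` (by `rfl`). [folklore] -/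
@[simp] theorem ΓPresheafAb_map_apply {U V : Scheme.{u}ᵒᵖ} (f : U ⟶ V) (s : Γ(U.unop, ⊤)) :
    (ΓPresheafAb.map f) s = f.unop.appTop s := rfl

/-- `U ↦ Γ(U, 𝓞_U)` is represented by the affine line `𝔸¹_ℤ = Spec ℤ[T]`
(`Hom(U, Spec ℤ[T]) = Γ(U, 𝓞_U)`, Mathlib `AffineSpace.toSpecMvPolyIntEquiv` with one variable).
[folklore] -/
def ΓPresheafAbRepresentableBy :
    (ΓPresheafAb.{u} ⋙ forget Ab.{u}).RepresentableBy
      (Spec (.of (MvPolynomial PUnit.{u + 1} (ULift.{u} ℤ)))) where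
  homEquiv {X} := (AffineSpace.toSpecMvPolyIntEquiv PUnit.{u + 1}).trans
    (Equiv.funUnique PUnit.{u + 1} Γ(X, ⊤))
  homEquiv_comp _ _ := rfl

/-- `U ↦ Γ(U, 𝓞_U)` is a sheaf for the fpqc topology (the fpqc topology is subcanonical — Mathlib
— and the presheaf is representable by `𝔸¹`), i.e. functions descend along fpqc covers
(Milne I 2.17 ff., II Cor. 1.6: `W(F)` is an fpqc sheaf for `F` quasi-coherent).
[cite: Milne2025, II Cor. 1.6] -/
theorem isSheaf_fpqcTopology_ΓPresheafAb :
    Presheaf.IsSheaf Scheme.fpqcTopology ΓPresheafAb.{u} := by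
  apply Presheaf.isSheaf_of_isSheaf_comp _ _ (forget Ab)
  rw [isSheaf_iff_isSheaf_of_type]
  haveI := ΓPresheafAbRepresentableBy.{u}.isRepresentable
  exact GrothendieckTopology.Subcanonical.isSheaf_of_isRepresentable _

/-! ### `𝔾ₐ` on the small étale site `Y_ét` -/

section Ga

variable (Y : Scheme.{u})

/-- **The sheaf `𝔾ₐ` on the small étale site `Y_ét`**: `U ↦ Γ(U, 𝓞_U)` (additive group) for
`U → Y` étale (Milne II 2.18 (c) notation `𝔾_a`; it is the sheaf `W(𝓞_Y)` of II 1.6, III 3.7),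
obtained by restricting the fpqc sheaf `ΓPresheafAb` along the continuous functor
`Y.Etale ⥤ Scheme`. [cite: Milne2025, II Cor. 1.6 and Examples 2.18 (c)] -/
def etaleGa : Sheaf Y.smallEtaleTopology Ab.{u} :=
  haveI := isContinuous_etaleForget_forget Y
  ((Scheme.Etale.forget Y ⋙ Over.forget Y).sheafPushforwardContinuous _ _
      Scheme.etaleTopology).obj
    ⟨ΓPresheafAb, .of_le
      (Scheme.etaleTopology_le_proetaleTopology.trans Scheme.proetaleTopology_le_fpqcTopology)
        isSheaf_fpqcTopology_ΓPresheafAb⟩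

/-- Sections of `𝔾ₐ` over `U → Y` étale are `Γ(U, 𝓞_U)` (by `rfl`). [folklore] -/
theorem etaleGa_obj (U : (Y.Etale)ᵒᵖ) :
    ((etaleGa Y).obj.obj U : Type u) = Γ(U.unop.left, ⊤) := rfl

/-- Restriction of `𝔾ₐ` along `i : V → U` in `Y_ét` is pullback of functions `i.appTop`
(by `rfl`). [folklore] -/
@[simp] theorem etaleGa_map_apply {U V : (Y.Etale)ᵒᵖ} (i : U ⟶ V) (s : Γ(U.unop.left, ⊤)) :
    ((etaleGa Y).obj.map i) s = i.unop.left.appTop s := rfl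

variable {Y}

/-- Restriction of global functions to an étale `Y`-scheme `U → Y`: the ring map
`Γ(Y, 𝓞_Y) → Γ(U, 𝓞_U)`. [folklore] -/
def resTop (U : Y.Etale) : Γ(Y, ⊤) →+* Γ(U.left, ⊤) := (U.hom.appTop).hom

/-- Unfolding `resTop`. [folklore] -/
theorem resTop_apply (U : Y.Etale) (c : Γ(Y, ⊤)) : resTop U c = U.hom.appTop c := rfl

/-- Restriction of global functions is compatible with `Y`-morphisms `i : V → U`:
`i^*(c|_U) = c|_V`. [folklore] -/
@[simp] theorem appTop_resTop {U V : Y.Etale} (i : V ⟶ U) (c : Γ(Y, ⊤)) :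
    i.left.appTop (resTop U c) = resTop V c := by
  have hw : V.hom = i.left ≫ U.hom := (MorphismProperty.Over.w i).symm
  have hc := congrArg (fun g : V.left ⟶ Y => g.appTop c) hw
  exact (hc.trans rfl).symm

/-- A family of additive endomorphisms of the rings of functions `Γ(U, 𝓞_U)`, `U ∈ Y_ét`,
commuting with pullback along étale `Y`-morphisms, defines an endomorphism of the sheaf `𝔾ₐ`.
[folklore] -/
def etaleGaEndOfFamily (φ : ∀ U : Y.Etale, Γ(U.left, ⊤) →+ Γ(U.left, ⊤))
    (hφ : ∀ {U V : Y.Etale} (i : V ⟶ U) (s : Γ(U.left, ⊤)),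
      i.left.appTop (φ U s) = φ V (i.left.appTop s)) :
    etaleGa Y ⟶ etaleGa Y :=
  ⟨{ app := fun U => AddCommGrpCat.ofHom (φ U.unop)
     naturality := fun U V i => by
       ext s
       exact (hφ i.unop s).symm }⟩

/-- On sections, `etaleGaEndOfFamily φ` is `φ` (by `rfl`). [folklore] -/
@[simp] theorem etaleGaEndOfFamily_app_apply (φ : ∀ U : Y.Etale, Γ(U.left, ⊤) →+ Γ(U.left, ⊤))
    (hφ : ∀ {U V : Y.Etale} (i : V ⟶ U) (s : Γ(U.left, ⊤)),
      i.left.appTop (φ U s) = φ V (i.left.appTop s))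
    (U : (Y.Etale)ᵒᵖ) (s : Γ(U.unop.left, ⊤)) :
    (etaleGaEndOfFamily φ hφ).hom.app U s = φ U.unop s := rfl

/-- Two morphisms out of `𝔾ₐ` into `𝔾ₐ` agree if they agree on all sections. [folklore] -/
theorem etaleGa_end_ext {f g : etaleGa Y ⟶ etaleGa Y}
    (h : ∀ (U : (Y.Etale)ᵒᵖ) (s : Γ(U.unop.left, ⊤)), f.hom.app U s = g.hom.app U s) : f = g := by
  ext U s
  exact h U s

/-! #### Multiplication by a global function: the `Γ(Y, 𝓞_Y)`-action on `𝔾ₐ` -/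

/-- Multiplication by (the restriction of) a global function `c ∈ Γ(Y, 𝓞_Y)` on `𝔾ₐ`:
on `U → Y` it is `s ↦ c|_U · s`. [folklore] -/
def etaleGaSMul (c : Γ(Y, ⊤)) : etaleGa Y ⟶ etaleGa Y :=
  etaleGaEndOfFamily (fun U => AddMonoidHom.mulLeft (resTop U c)) fun {U V} i s => by
    simp only [AddMonoidHom.coe_mulLeft, map_mul, appTop_resTop]

/-- On sections, `etaleGaSMul c` is `s ↦ c|_U · s` (by `rfl`). [folklore] -/
@[simp] theorem etaleGaSMul_app_apply (c : Γ(Y, ⊤)) (U : (Y.Etale)ᵒᵖ)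
    (s : Γ(U.unop.left, ⊤)) : (etaleGaSMul c).hom.app U s = resTop U.unop c * s := rfl

variable (Y) in
/-- **The `Γ(Y, 𝓞_Y)`-module structure of `𝔾ₐ`** as a ring homomorphism
`Γ(Y, 𝓞_Y) → End(𝔾ₐ)`, `c ↦` multiplication by `c` (note `f * g = g ≫ f` in `End`).
[folklore] -/
def etaleGaScalar : Γ(Y, ⊤) →+* End (etaleGa Y) where
  toFun c := etaleGaSMul c
  map_one' := etaleGa_end_ext fun U s => by simp
  map_mul' c d := etaleGa_end_ext fun U s => by
    simp only [etaleGaSMul_app_apply, map_mul, End.mul_def]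
    change _ = resTop U.unop c * (resTop U.unop d * s)
    ring
  map_zero' := etaleGa_end_ext fun U s => by
    simp only [etaleGaSMul_app_apply, map_zero, zero_mul]
    rfl
  map_add' c d := etaleGa_end_ext fun U s => by
    simp only [etaleGaSMul_app_apply, map_add, add_mul]
    rfl

/-- Unfolding `etaleGaScalar`. [folklore] -/
theorem etaleGaScalar_apply (c : Γ(Y, ⊤)) : etaleGaScalar Y c = etaleGaSMul c := rfl

/-! #### The Frobenius `F : s ↦ s ^ p` on `𝔾ₐ` in characteristic `p` -/

/-- In a commutative ring in which the prime `p` vanishes, `x ↦ x ^ p` is additive (the zero ring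
included). [folklore] -/
theorem add_pow_prime_of_cast_eq_zero {R : Type*} [CommRing R] {p : ℕ} [hp : Fact p.Prime]
    (h : (p : R) = 0) (x y : R) : (x + y) ^ p = x ^ p + y ^ p := by
  rcases subsingleton_or_nontrivial R with hR | hR
  · exact Subsingleton.elim _ _
  · haveI : CharP R p := (CharP.charP_iff_prime_eq_zero hp.out).2 h
    exact add_pow_char x y p

/-- The `p`-th power map of a commutative ring in which the prime `p` vanishes, as an additive
endomorphism (the absolute Frobenius `F`). [folklore] -/
def powAddMonoidHom (R : Type*) [CommRing R] (p : ℕ) [hp : Fact p.Prime] (h : (p : R) = 0) :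
    R →+ R where
  toFun x := x ^ p
  map_zero' := zero_pow hp.out.ne_zero
  map_add' x y := add_pow_prime_of_cast_eq_zero h x y

/-- Unfolding `powAddMonoidHom`. [folklore] -/
@[simp] theorem powAddMonoidHom_apply (R : Type*) [CommRing R] (p : ℕ) [Fact p.Prime]
    (h : (p : R) = 0) (x : R) : powAddMonoidHom R p h x = x ^ p := rfl

/-- If `p = 0` in `Γ(Y, 𝓞_Y)` then `p = 0` in `Γ(U, 𝓞_U)` for every étale `U → Y`. [folklore] -/
theorem cast_eq_zero_etale {p : ℕ} (hp : (p : Γ(Y, ⊤)) = 0) (U : Y.Etale) :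
    (p : Γ(U.left, ⊤)) = 0 := by
  simpa using congrArg (resTop U) hp

/-- **The Frobenius endomorphism `F : s ↦ s ^ p` of `𝔾ₐ` on `Y_ét`** for a scheme `Y` of
characteristic `p` (`p = 0` in `Γ(Y, 𝓞_Y)`; Milne II 2.18 (c): "`F` is the map `a ↦ a^p`").
[cite: Milne2025, II Examples 2.18 (c)] -/
def etaleGaFrob (p : ℕ) [Fact p.Prime] (hp : (p : Γ(Y, ⊤)) = 0) : etaleGa Y ⟶ etaleGa Y :=
  etaleGaEndOfFamily (fun U => powAddMonoidHom _ p (cast_eq_zero_etale hp U)) fun i s => by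
    simp

/-- On sections, the Frobenius of `𝔾ₐ` is `s ↦ s ^ p` (by `rfl`). [folklore] -/
@[simp] theorem etaleGaFrob_app_apply (p : ℕ) [Fact p.Prime] (hp : (p : Γ(Y, ⊤)) = 0)
    (U : (Y.Etale)ᵒᵖ) (s : Γ(U.unop.left, ⊤)) : (etaleGaFrob p hp).hom.app U s = s ^ p := rfl

/-- **`F` is `p`-linear**: `F ∘ (c ·) = (c ^ p ·) ∘ F` as endomorphisms of `𝔾ₐ`
(`(c s)^p = c^p s^p`). [folklore] -/
theorem etaleGaSMul_comp_etaleGaFrob (p : ℕ) [Fact p.Prime] (hp : (p : Γ(Y, ⊤)) = 0)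
    (c : Γ(Y, ⊤)) :
    etaleGaSMul c ≫ etaleGaFrob p hp = etaleGaFrob p hp ≫ etaleGaSMul (c ^ p) :=
  etaleGa_end_ext fun U s => by
    change (resTop U.unop c * s) ^ p = resTop U.unop (c ^ p) * s ^ p
    rw [mul_pow, map_pow]

end Ga

/-! ### `𝔾ₐ` of a scheme over a ring `K`: the `K`-vector-space structure of `Hⁿ(Y_ét, 𝔾ₐ)` -/

section Over

variable {K : Type u} [CommRing K] {Y : Scheme.{u}} (f : Y ⟶ Spec (.of K))

/-- `𝔾ₐ` on `Y_ét` for a `K`-scheme `f : Y → Spec K`. This is `etaleGa Y` (by `rfl`); the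
structure morphism is recorded in the type so that `Hⁿ(Y_ét, 𝔾ₐ)` carries its `K`-module
structure as an instance (`moduleEtaleGaOverH`). [folklore] -/
def etaleGaOver (_f : Y ⟶ Spec (.of K)) : Sheaf Y.smallEtaleTopology Ab.{u} := etaleGa Y

/-- `etaleGaOver f` is `etaleGa Y` (by `rfl`). [folklore] -/
theorem etaleGaOver_eq : etaleGaOver f = etaleGa Y := rfl

/-- The structure map on functions `K → Γ(Y, 𝓞_Y)` of a `K`-scheme `f : Y → Spec K`
(`f^* ∘ (Γ(Spec K, 𝓞) ≅ K)⁻¹`). [folklore] -/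
def algebraMapTop : K →+* Γ(Y, ⊤) :=
  f.appTop.hom.comp (Scheme.ΓSpecIso (.of K)).inv.hom

/-- Multiplication by the scalar `c ∈ K` on `𝔾ₐ` of a `K`-scheme. [folklore] -/
def etaleGaSMulOver (c : K) : etaleGaOver f ⟶ etaleGaOver f := etaleGaSMul (algebraMapTop f c)

/-- On sections over `U → Y`, `etaleGaSMulOver f c` is `s ↦ c|_U · s` (by `rfl`). [folklore] -/
theorem etaleGaSMulOver_app_apply (c : K) (U : (Y.Etale)ᵒᵖ) (s : Γ(U.unop.left, ⊤)) :
    (etaleGaSMulOver f c).hom.app U s = resTop U.unop (algebraMapTop f c) * s := rfl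

/-- **The `K`-linear structure of `𝔾ₐ`** on a `K`-scheme: `K → End(𝔾ₐ)`, `c ↦` multiplication
by `c`. [folklore] -/
def etaleGaScalarOver : K →+* End (etaleGaOver f) :=
  (etaleGaScalar Y).comp (algebraMapTop f)

/-- Unfolding `etaleGaScalarOver` (by `rfl`). [folklore] -/
theorem etaleGaScalarOver_apply (c : K) : etaleGaScalarOver f c = etaleGaSMulOver f c := rfl

/-- **`Hⁿ(Y_ét, 𝔾ₐ)` is a `K`-module** for a `K`-scheme `Y`, `c ∈ K` acting through
`Hⁿ` of multiplication by `c` on `𝔾ₐ` (functoriality of `Hⁿ = Extⁿ(ℤ, –)`, Mathlib `Sheaf.H.map`).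
[folklore] -/
instance moduleEtaleGaOverH (n : ℕ) : Module K ((etaleGaOver f).H n) :=
  letI := moduleEndSheafH (etaleGaOver f) n
  Module.compHom _ (etaleGaScalarOver f)

/-- The scalar multiplication on `Hⁿ(Y_ét, 𝔾ₐ)` is `c • x = Hⁿ(c ·)(x)` (by `rfl`). [folklore] -/
theorem etaleGaOverH_smul_def (n : ℕ) (c : K) (x : (etaleGaOver f).H n) :
    c • x = Sheaf.H.map (etaleGaSMulOver f c) n x :=
  rfl

variable (p : ℕ) [CharP K p]

include f in
/-- On a scheme over a ring of characteristic `p`, `p = 0` in `Γ(Y, 𝓞_Y)`. [folklore] -/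
theorem cast_eq_zero_top_of_charP : (p : Γ(Y, ⊤)) = 0 := by
  have h := congrArg (algebraMapTop f) (CharP.cast_eq_zero K p)
  rwa [map_natCast, map_zero] at h

variable [Fact p.Prime]

/-- The Frobenius `F` of `𝔾ₐ` on a scheme over a ring of characteristic `p`, as an endomorphism
of `etaleGaOver f`. [cite: Milne2025, II Examples 2.18 (c)] -/
def etaleGaOverFrob : etaleGaOver f ⟶ etaleGaOver f :=
  etaleGaFrob p (cast_eq_zero_top_of_charP f p)

/-- On sections, `etaleGaOverFrob` is `s ↦ s ^ p` (by `rfl`). [folklore] -/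
theorem etaleGaOverFrob_app_apply (U : (Y.Etale)ᵒᵖ) (s : Γ(U.unop.left, ⊤)) :
    (etaleGaOverFrob f p).hom.app U s = s ^ p := rfl

/-- **`F` is `p`-linear** on a `K`-scheme: `(c ·) ≫ F = F ≫ (c ^ p ·)` as endomorphisms of `𝔾ₐ`
(`(c s)^p = c^p s^p`). [folklore] -/
theorem etaleGaSMulOver_comp_frob (c : K) :
    etaleGaSMulOver f c ≫ etaleGaOverFrob f p =
      etaleGaOverFrob f p ≫ etaleGaSMulOver f (c ^ p) := by
  refine etaleGa_end_ext fun U s => ?_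
  change (resTop U.unop (algebraMapTop f c) * s) ^ p =
    resTop U.unop (algebraMapTop f (c ^ p)) * s ^ p
  rw [mul_pow, map_pow, map_pow]

/-- **The Frobenius `φ = Hⁿ(F)` on `Hⁿ(Y_ét, 𝔾ₐ)`** (an additive endomorphism).
[cite: Milne2025, III §4 (Artin–Schreier theory)] -/
def frobeniusH (n : ℕ) : (etaleGaOver f).H n →+ (etaleGaOver f).H n :=
  Sheaf.H.map (etaleGaOverFrob f p) n

/-- Unfolding `frobeniusH` (by `rfl`). [folklore] -/
theorem frobeniusH_apply (n : ℕ) (x : (etaleGaOver f).H n) :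
    frobeniusH f p n x = Sheaf.H.map (etaleGaOverFrob f p) n x := rfl

/-- **`φ = Hⁿ(F)` is `p`-linear**: `φ(c • x) = c ^ p • φ(x)` on `Hⁿ(Y_ét, 𝔾ₐ)` (from
`(c ·) ≫ F = F ≫ (c^p ·)` on `𝔾ₐ` and functoriality of `Hⁿ`). [folklore] -/
theorem frobeniusH_smul (n : ℕ) (c : K) (x : (etaleGaOver f).H n) :
    frobeniusH f p n (c • x) = c ^ p • frobeniusH f p n x := by
  rw [frobeniusH_apply, frobeniusH_apply, etaleGaOverH_smul_def, etaleGaOverH_smul_def,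
    ← Sheaf.H.map_comp_apply, ← Sheaf.H.map_comp_apply, etaleGaSMulOver_comp_frob]

/-- `Hⁿ(F - 1) = φ - id` on `Hⁿ(Y_ét, 𝔾ₐ)`. [folklore] -/
theorem sheafH_map_frob_sub_id (n : ℕ) (x : (etaleGaOver f).H n) :
    Sheaf.H.map (etaleGaOverFrob f p - 𝟙 _) n x = frobeniusH f p n x - x := by
  rw [sheafH_map_sub_apply, Sheaf.H.map_id_apply, frobeniusH_apply]

end Over

end Literature.AlgebraicGeometry.Motives

end
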